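import Summits.CriticalPhenomena.Ising3DConformalLimit.Theses.ThresholdDilation
import Summits.CriticalPhenomena.Ising3DConformalLimit.Theorems.ThresholdDilationDyadicLawOfImplementer

/-!
# ThresholdDilation — assembly glue (item stmt-CriticalPhenomena-15218; formerly stmt-CriticalPhenomena-6329)

The chain of route `ThresholdDilation` as one implication:
`TwoPlaneTransferRealisation → ThresholdDilationImplementer → ConformalLimitOfDyadicLaw →
Ising3DConformalLimit`.

History: at route rev ≤ 4 the item `Assembly` (stmt-CriticalPhenomena-6329) read
`(R) → (V) → DyadicLawOfImplementer → (C) → Ising3DConformalLimit` and was proved here by pure logic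
(`intro hR hV hGlue hC; exact hC (hGlue hR hV)`, accepted @ f1a4c209c52c). The route repair of
2026-08-16T14:03:51Z RESTATED the item (→ stmt-CriticalPhenomena-15218) without the glue hypothesis,
because the old form was binder-for-binder the type of the deciding theorem `closes` and hence
tauto-closable; the four-binder proof then stopped elaborating against the regenerated route file
(full build 2026-08-16T23:32Z, `introN`). This revision proves the restated item.

Proof: the glue support `DyadicLawOfImplementer` — `(R) → (V) → DyadicScalingLaw` — is a theorem in
tree (`ThresholdDilationGlue.dyadicLawOfImplementer_proof`,
`Theorems/ThresholdDilationDyadicLawOfImplementer.lean`, item stmt-CriticalPhenomena-6325); fed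
(R) = `TwoPlaneTransferRealisation` and (V) = `ThresholdDilationImplementer` it yields
`DyadicScalingLaw`, whose statement is verbatim the antecedent of the imported complement
`ConformalLimitOfDyadicLaw`, which then returns the conjunct `Ising3DConformalLimit`. No named facts
are used; the theorem is unconditional.
-/

namespace Summit.CriticalPhenomena.Ising3DConformalLimit.Theorems

open Summit.CriticalPhenomena.Ising3DConformalLimit.Theses.ThresholdDilation

/-- **Assembly glue of route ThresholdDilation** (item stmt-CriticalPhenomena-15218, the restated
successor of stmt-CriticalPhenomena-6329): the implication
`TwoPlaneTransferRealisation → ThresholdDilationImplementer → ConformalLimitOfDyadicLaw →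
Ising3DConformalLimit` — the landed glue theorem `ThresholdDilationGlue.dyadicLawOfImplementer_proof`
turns (R) and (V) into `DyadicScalingLaw`, and the imported complement `ConformalLimitOfDyadicLaw`
turns the dyadic scaling law into the conjunct. [folklore] -/
theorem thresholdDilation_assembly_proof :
    Summit.CriticalPhenomena.Ising3DConformalLimit.Theses.ThresholdDilation.Assembly := by
  unfold Summit.CriticalPhenomena.Ising3DConformalLimit.Theses.ThresholdDilation.Assembly
  intro hR hV hC
  -- `dyadicLawOfImplementer_proof hR hV : DyadicScalingLaw`, definitionally the antecedent of `hC`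
  exact hC
    (Summit.CriticalPhenomena.Ising3DConformalLimit.ThresholdDilationGlue.dyadicLawOfImplementer_proof
      hR hV)

end Summit.CriticalPhenomena.Ising3DConformalLimit.Theorems
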